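import Literature.NumberTheory.Automorphic.SLTwoTreeQuadraticTorusShellDecomposition   -- ★ part II (A-p17 (g23), R1LL-WILD (W′1)) p843931: `exists_torus_shell_eq`, `torus_shell_unique`; part I p843889 `glVertexAct_torus_shell_eq_iff`
import HarnessLib

/-!
# The non-split quadratic torus on the tree of `SL₂(F)`, III: the SHELL INDEX as a function and `Fix(γ)` as a BALL (Labesse–Langlands 1979, §2 p. 8)

Topic `NumberTheory/Automorphic`; namespace `Literature.NumberTheory.Automorphic.HermitianLatticeTree` (ROAD W's).  KERNEL mathematics only: theorems, no definition, no
named fact, no instance, no notation, no `sorry`.  Cell `pub/hodgecm-mathlib` (D-0151), crux H413 = `stmt-HodgeConjecture-24833`, line «N6nsGerm», the WILDLY RAMIFIED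
residue «R1-CM-ram-wild» of books row #159 ∕ #165 — opportunistic brick **«R1LL-WILD (W′1)» «THE TORUS IN THE TREE»**, part III (A-p12 (g19)'s census
`F0/P3a/A-p12/g19/CENSUS-R1LL-wild.A-p12g19.md` §2; LEAD F0P3a-plan (g10) WORD T9-22 (4); seat A-p17 (g23), census `A-provers/A-p17/g23/CENSUS-W1prime-TorusInTree.A-p17g23.md`).
Parts I–II = ★ `SLTwoTreeQuadraticTorusFixedShells` p843889 (stabiliser test, LL (2.1), fixed shells) and ★ `SLTwoTreeQuadraticTorusShellDecomposition` p843931 (every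
vertex is `t · diag(1, ϖ^m) · v₀`; `m` is unique).  This part packages them in the shape B-p14 (g33)'s (W′2) census `CENSUS-W2prime-WeightedUnfoldingAction` §2–§3 consumes:
a DEPTH ∕ SHELL-INDEX FUNCTION `d : V → ℕ` on the vertex type and «`{x | act γ x = x}` is the ball `{x | d x ≤ ord b}`».
HONEST LABEL: HC_CM is proved only modulo the cell's 2 remaining named inputs (hLiu418, h413) until rung 0 closes; nothing printed is asserted here — elementary lattice
algebra over a discrete valuation ring.

THE MATHEMATICS (notation of parts I–II: `X` the tree of `SL₂(F)` with vertex type `V`, root `v₀ = 𝒪²`, torus `T = {(c, dv; d, c + du)} ⊂ GL₂(F)` = the regular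
representation of `F[τ]^×`, `τ² = uτ + v` with `u v ∈ 𝒪`, non-split ∕ integral-basis binder `hE : |p² + pqu − q²v| ≤ 1 ⇒ p, q ∈ 𝒪`, shell representatives
`g_m = diag(1, ϖ^m)`).  No `def` is introduced: the shell index is delivered as an EXISTENTIAL FUNCTION (choice inside the proof), which a consumer destructures once.
* §6 `exists_shellIndex`: **there is `d : V → ℕ` with (i) every vertex `x` is `t · g_{d x} · v₀` for some torus `t`, and (ii) `d (t · g_m · v₀) = m`** for every torus `t`
  and every `m` — i.e. `d` = «the `m` of LL79 p. 8, uniquely determined» = the conductor exponent of the multiplier order of the lattice (★ `exists_torus_shell_eq` +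
  ★ `torus_shell_unique`).
* §7 **`Fix(γ)` IS A BALL** `glVertexAct_torus_eq_self_iff_le_shellIndex` ∕ `setOf_glVertexAct_torus_eq_self_eq`: for such a `d` and every unit `γ = (a, bv; b, a+bu)` of the
  order (`a b ∈ 𝒪`, `|det γ| = 1`): **`γ · x = x ⟺ |b| ≤ |ϖ|^{d x}`**, i.e. `{x | γ · x = x} = {x | |b| ≤ |ϖ| ^ d x}` — the ball of radius `ord b` about the facet of `T`
  (all of `X` when `b = 0`, i.e. `γ` central) (★ `glVertexAct_torus_shell_eq_iff`).  In (W′2)'s binders: `act := glVertexAct hϖ` (`act_one` ∕ `act_mul` = ★ `glVertexAct_one` ∕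
  `glVertexAct_mul`), `S = {x | act γ x = x}`, depth `d`, and the value law along `min (d x) (ord b)` is (W′3)-ALG's ((★ p843859 `forall_v_shellConj_sub_le`).
NOT here: shell CARDINALITIES `#{x | d x = m}` (= `[T : T ∩ g_m GL₂(𝒪) g_m⁻¹ F^×]`, LL's `δ_m`; finite only over a finite residue field — on request), the tree-METRIC reading
`d x = dist(x, e₀)` (not needed by R1LL), the transport through `ρ : U(Φ₂)(E_w) → PGL₂(F_v)` ((W′6)).

## References
* [LabesseLanglands1979] J.-P. Labesse, R. P. Langlands, *L-indistinguishability for SL(2)*, Canad. J. Math. 31 (1979), §2 p. 8 («it is clear that `m` is uniquely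
  determined»; representatives `diag(1, ϖ^m)`).
* [Serre1980Trees] J.-P. Serre, *Trees* (1980), Ch. II §1.1 Theorem 1, §1.3.
-/

set_option autoImplicit false

noncomputable section

open scoped ValuativeRel Matrix MatrixGroups
open Matrix ValuativeRel

namespace Literature.NumberTheory.Automorphic.HermitianLatticeTree

open Literature.NumberTheory.Automorphic Literature.NumberTheory.LocalFields

variable {F : Type*} [Field F] [ValuativeRel F] {ϖ : F} (hϖ : IsUniformizingElement ϖ) [IsDiscreteValuationRing 𝒪[F]]

/-! ## §6 The shell index as a function on the vertices -/

include hϖ in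
/-- **THE SHELL INDEX** (LL79 p. 8: «it is clear that `m` is uniquely determined»): under the non-split ∕ integral-basis hypothesis `hE` (and `u v ∈ 𝒪`) there is a
function `d : V → ℕ` on the vertices of the tree of `SL₂(F)` such that (i) every vertex `x` is `t · diag(1, ϖ^{d x}) · v₀` for a torus element `t`, and (ii)
`d (t · diag(1, ϖ^m) · v₀) = m` for EVERY torus `t` and every `m` — the shells `{x | d x = m}` are the `T`-orbits `T · g_m · v₀`.  (No definition: `d` is obtained by
choice from ★ `exists_torus_shell_eq` and pinned by ★ `torus_shell_unique`; a consumer destructures this once.) [cite: LabesseLanglands1979, §2 p. 8]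
[cite: Serre1980Trees, Ch. II §1.1 Theorem 1] -/
theorem exists_shellIndex {u v : F} (hu : u ∈ 𝒪[F]) (hv : v ∈ 𝒪[F])
    (hE : ∀ p q : F, valuation F (p ^ 2 + p * q * u - q ^ 2 * v) ≤ 1 → p ∈ 𝒪[F] ∧ q ∈ 𝒪[F])
    (v₀ : {M : Submodule 𝒪[F] (Fin 2 → F) // IsSpecialLattice (RingHom.id F) ϖ !![(0 : F), 1; -1, 0] M})
    (hv₀ : v₀.1 = latt (1 : Matrix (Fin 2) (Fin 2) F)) :
    ∃ d : {M : Submodule 𝒪[F] (Fin 2 → F) // IsSpecialLattice (RingHom.id F) ϖ !![(0 : F), 1; -1, 0] M} → ℕ,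
      (∀ x, ∃ (t gm : GL (Fin 2) F) (c e : F), (t : Matrix (Fin 2) (Fin 2) F) = !![c, e * v; e, c + e * u] ∧
        (gm : Matrix (Fin 2) (Fin 2) F) = Matrix.diagonal ![1, ϖ ^ d x] ∧ x = glVertexAct hϖ (t * gm) v₀) ∧
      (∀ (x) (t gm : GL (Fin 2) F) (c e : F) (m : ℕ), (t : Matrix (Fin 2) (Fin 2) F) = !![c, e * v; e, c + e * u] →
        (gm : Matrix (Fin 2) (Fin 2) F) = Matrix.diagonal ![1, ϖ ^ m] → x = glVertexAct hϖ (t * gm) v₀ → d x = m) := by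
  have hv0 : v ≠ 0 := ne_zero_of_quadNormForm_integral hϖ hE
  -- the shell index of `x`, by choice
  have hex : ∀ x : {M : Submodule 𝒪[F] (Fin 2 → F) // IsSpecialLattice (RingHom.id F) ϖ !![(0 : F), 1; -1, 0] M},
      ∃ (m : ℕ) (t gm : GL (Fin 2) F) (c e : F), (t : Matrix (Fin 2) (Fin 2) F) = !![c, e * v; e, c + e * u] ∧
        (gm : Matrix (Fin 2) (Fin 2) F) = Matrix.diagonal ![1, ϖ ^ m] ∧ x = glVertexAct hϖ (t * gm) v₀ := by
    intro x
    obtain ⟨t, gm, c, e, m, ht, hgm, hx⟩ := exists_torus_shell_eq hϖ hE v₀ hv₀ x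
    exact ⟨m, t, gm, c, e, ht, hgm, hx⟩
  refine ⟨fun x => Classical.choose (hex x), fun x => Classical.choose_spec (hex x), ?_⟩
  intro x t gm c e m ht hgm hx
  obtain ⟨t', gm', c', e', ht', hgm', hx'⟩ := Classical.choose_spec (hex x)
  rw [hx'] at hx
  exact torus_shell_unique hϖ hu hv hv0 ht' ht hgm' hgm v₀ hv₀ hx

/-! ## §7 `Fix(γ)` is a ball about the facet of the torus -/

include hϖ in
/-- **`Fix(γ)` IS A BALL, pointwise**: let `d : V → ℕ` be ANY function with the two properties of `exists_shellIndex` (it suffices that every vertex is `t · g_{d x} · v₀`).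
Then for a unit `γ = (a, bv; b, a+bu)` of the order `𝒪 ⊕ 𝒪τ` (`a b u v ∈ 𝒪`, `|det γ| = 1`): **`γ · x = x ⟺ |b| ≤ |ϖ|^{d x}`** (★ `glVertexAct_torus_shell_eq_iff`).
[cite: LabesseLanglands1979, §2 p. 8] [cite: Serre1980Trees, Ch. II §1.3] -/
theorem glVertexAct_torus_eq_self_iff_le_shellIndex {u v a b : F} (hu : u ∈ 𝒪[F]) (hv : v ∈ 𝒪[F]) (ha : a ∈ 𝒪[F]) (hb : b ∈ 𝒪[F])
    {γ : GL (Fin 2) F} (hγ : (γ : Matrix (Fin 2) (Fin 2) F) = !![a, b * v; b, a + b * u]) (hγdet : valuation F (γ : Matrix (Fin 2) (Fin 2) F).det = 1)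
    (v₀ : {M : Submodule 𝒪[F] (Fin 2 → F) // IsSpecialLattice (RingHom.id F) ϖ !![(0 : F), 1; -1, 0] M})
    (hv₀ : v₀.1 = latt (1 : Matrix (Fin 2) (Fin 2) F))
    {d : {M : Submodule 𝒪[F] (Fin 2 → F) // IsSpecialLattice (RingHom.id F) ϖ !![(0 : F), 1; -1, 0] M} → ℕ}
    (hd : ∀ x, ∃ (t gm : GL (Fin 2) F) (c e : F), (t : Matrix (Fin 2) (Fin 2) F) = !![c, e * v; e, c + e * u] ∧
      (gm : Matrix (Fin 2) (Fin 2) F) = Matrix.diagonal ![1, ϖ ^ d x] ∧ x = glVertexAct hϖ (t * gm) v₀)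
    (x : {M : Submodule 𝒪[F] (Fin 2 → F) // IsSpecialLattice (RingHom.id F) ϖ !![(0 : F), 1; -1, 0] M}) :
    glVertexAct hϖ γ x = x ↔ valuation F b ≤ valuation F ϖ ^ d x := by
  obtain ⟨t, gm, c, e, ht, hgm, hx⟩ := hd x
  have h := glVertexAct_torus_shell_eq_iff hϖ hu hv ha hb hγ hγdet ht hgm v₀ hv₀
  rw [← hx] at h
  exact h

include hϖ in
/-- **`Fix(γ)` IS A BALL, as a set**: with `d` as in `exists_shellIndex` and `γ = (a, bv; b, a+bu)` a unit of the order, `{x | γ · x = x} = {x | |b| ≤ |ϖ| ^ d x}` — the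
ball of radius `ord b` about the facet of `T` (the whole tree when `b = 0`).  This is the set `S = {x | act γ x = x}` of (W′2)'s weighted unfolding, with its depth
stratification `d`. [cite: LabesseLanglands1979, §2 p. 8] [cite: Serre1980Trees, Ch. II §1.3] -/
theorem setOf_glVertexAct_torus_eq_self_eq {u v a b : F} (hu : u ∈ 𝒪[F]) (hv : v ∈ 𝒪[F]) (ha : a ∈ 𝒪[F]) (hb : b ∈ 𝒪[F])
    {γ : GL (Fin 2) F} (hγ : (γ : Matrix (Fin 2) (Fin 2) F) = !![a, b * v; b, a + b * u]) (hγdet : valuation F (γ : Matrix (Fin 2) (Fin 2) F).det = 1)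
    (v₀ : {M : Submodule 𝒪[F] (Fin 2 → F) // IsSpecialLattice (RingHom.id F) ϖ !![(0 : F), 1; -1, 0] M})
    (hv₀ : v₀.1 = latt (1 : Matrix (Fin 2) (Fin 2) F))
    {d : {M : Submodule 𝒪[F] (Fin 2 → F) // IsSpecialLattice (RingHom.id F) ϖ !![(0 : F), 1; -1, 0] M} → ℕ}
    (hd : ∀ x, ∃ (t gm : GL (Fin 2) F) (c e : F), (t : Matrix (Fin 2) (Fin 2) F) = !![c, e * v; e, c + e * u] ∧
      (gm : Matrix (Fin 2) (Fin 2) F) = Matrix.diagonal ![1, ϖ ^ d x] ∧ x = glVertexAct hϖ (t * gm) v₀) :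
    {x | glVertexAct hϖ γ x = x} = {x | valuation F b ≤ valuation F ϖ ^ d x} := by
  ext x
  exact glVertexAct_torus_eq_self_iff_le_shellIndex hϖ hu hv ha hb hγ hγdet v₀ hv₀ hd x

include hϖ in
/-- **Monotonicity of the balls**: if `|b| ≤ |ϖ|^{d x}` fails at `x` it fails at every vertex of larger shell index — equivalently `Fix(γ)` is DOWNWARD CLOSED in `d`:
`γ · x = x` and `d y ≤ d x` imply `γ · y = y`. [cite: LabesseLanglands1979, §2 p. 8] -/
theorem glVertexAct_torus_eq_self_of_shellIndex_le {u v a b : F} (hu : u ∈ 𝒪[F]) (hv : v ∈ 𝒪[F]) (ha : a ∈ 𝒪[F]) (hb : b ∈ 𝒪[F])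
    {γ : GL (Fin 2) F} (hγ : (γ : Matrix (Fin 2) (Fin 2) F) = !![a, b * v; b, a + b * u]) (hγdet : valuation F (γ : Matrix (Fin 2) (Fin 2) F).det = 1)
    (v₀ : {M : Submodule 𝒪[F] (Fin 2 → F) // IsSpecialLattice (RingHom.id F) ϖ !![(0 : F), 1; -1, 0] M})
    (hv₀ : v₀.1 = latt (1 : Matrix (Fin 2) (Fin 2) F))
    {d : {M : Submodule 𝒪[F] (Fin 2 → F) // IsSpecialLattice (RingHom.id F) ϖ !![(0 : F), 1; -1, 0] M} → ℕ}
    (hd : ∀ x, ∃ (t gm : GL (Fin 2) F) (c e : F), (t : Matrix (Fin 2) (Fin 2) F) = !![c, e * v; e, c + e * u] ∧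
      (gm : Matrix (Fin 2) (Fin 2) F) = Matrix.diagonal ![1, ϖ ^ d x] ∧ x = glVertexAct hϖ (t * gm) v₀)
    {x y : {M : Submodule 𝒪[F] (Fin 2 → F) // IsSpecialLattice (RingHom.id F) ϖ !![(0 : F), 1; -1, 0] M}}
    (hx : glVertexAct hϖ γ x = x) (hyx : d y ≤ d x) : glVertexAct hϖ γ y = y := by
  rw [glVertexAct_torus_eq_self_iff_le_shellIndex hϖ hu hv ha hb hγ hγdet v₀ hv₀ hd] at hx ⊢
  exact hx.trans (pow_le_pow_right_of_le_one' hϖ.valuation_le_one hyx)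

include hϖ in
/-- **The root has shell index `0`** (`v₀ = 1 · g_0 · v₀`), so every unit of the order fixes `v₀`. [cite: LabesseLanglands1979, §2 p. 8] -/
theorem shellIndex_root_eq_zero {u v : F}
    (v₀ : {M : Submodule 𝒪[F] (Fin 2 → F) // IsSpecialLattice (RingHom.id F) ϖ !![(0 : F), 1; -1, 0] M})
    {d : {M : Submodule 𝒪[F] (Fin 2 → F) // IsSpecialLattice (RingHom.id F) ϖ !![(0 : F), 1; -1, 0] M} → ℕ}
    (hd' : ∀ (x) (t gm : GL (Fin 2) F) (c e : F) (m : ℕ), (t : Matrix (Fin 2) (Fin 2) F) = !![c, e * v; e, c + e * u] →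
      (gm : Matrix (Fin 2) (Fin 2) F) = Matrix.diagonal ![1, ϖ ^ m] → x = glVertexAct hϖ (t * gm) v₀ → d x = m) :
    d v₀ = 0 := by
  refine hd' v₀ 1 1 1 0 0 ?_ ?_ ?_
  · rw [Units.val_one]
    ext i j
    fin_cases i <;> fin_cases j <;> simp
  · rw [Units.val_one, pow_zero, ← Matrix.diagonal_one]
    congr 1
    funext i
    fin_cases i <;> rfl
  · rw [mul_one, glVertexAct_one]

end Literature.NumberTheory.Automorphic.HermitianLatticeTree

end
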